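import Summits.QuantumAdvantage.QuantumAdvantage.Theorems.RankDialL3
import HarnessLib

/-!
# RankDial (L4) — §32 THE DICTIONARY CERTIFIED: `ringWinU` on a block fibre = `WinLabel` of the block label (addendum to node «BlockDial»)

TARGET BY NAME (cell decomp-qadv, RESIDUAL MODE): item stmt-QuantumAdvantage-23109
`Summit.QuantumAdvantage.QuantumAdvantage.Theses.OddPrimeWalk.ManyReadersSqrtOdd`, through rung R5 = `AdviceFreeQNC0.WalkHardFLinSel p`.
This file SUPPORTS the item (`--supports`); it does not close it.  Declaration bodies are byte-identical to §32 of the cell node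
«BlockDial» (decomp-qadv lens-1, generation 27, part L; node file RankDialL.lean, rev 2).  It certifies the dictionary behind the
multi-liveness law of part L3: for `u = a ++ v ++ b` with the pass set `P` of cuts fixed and classified (`none` = outside the block,
`some j` = at the inside position `h j`), `ringWinU c y u = true ↔ WinLabel kind deadVal (blockLabel v)` where
`blockLabel v = (|v| ; |v_{<h_j − L}|) mod 3` and `deadVal` depends on the charge, the position and the OUTSIDE bits only
(`ringWinU_glue3_iff_winLabel`, `card_win_eq_card_winLabel`).  Imports part L3 only.
-/

set_option linter.dupNamespace false
set_option autoImplicit false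

noncomputable section
open Classical

namespace Summit.QuantumAdvantage.QuantumAdvantage.Theorems.RankDial

open Finset
open Summit.QuantumAdvantage.AdviceFreeQNC0
open Literature.Computability.MetaComplexity Literature.Computability.MetaComplexity.Smolensky

/-! ### §32 (part L «BlockDial») THE DICTIONARY CERTIFIED: `ringWinU` on a block fibre = `WinLabel` of the block label -/

section WalkBridge
variable {L ℓ R : ℕ} (c : ℕ) (y : Fin (L + ℓ + R + 1) → (Fin (L + ℓ + R) → Bool) → Bool)
  (a : Fin L → Bool) (b : Fin R → Bool)

/-- `N % 3 ≠ 0 ↔ (N : ℤ₃) ≠ 0`. -/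
theorem natMod3_ne_zero_iff (N : ℕ) : N % 3 ≠ 0 ↔ (N : ZMod 3) ≠ 0 := by
  rw [Ne, Ne, ZMod.natCast_eq_zero_iff, Nat.dvd_iff_mod_eq_zero]

/-- the three affine solves in `ℤ₃` (left cut, right cut, inside cut) -/
theorem zmod3_solve_left (K x : ZMod 3) : (x + 0 = -K) ↔ ¬ (K + x ≠ 0) := by
  revert K x; decide

/-- right cut: `K + 2x = 0 ↔ x = K` in `ℤ₃`. -/
theorem zmod3_solve_right (K x : ZMod 3) : (x + 0 = K) ↔ ¬ (K + 2 * x ≠ 0) := by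
  revert K x; decide

/-- inside cut: `K + x + w = 0 ↔ x + w = -K` in `ℤ₃`. -/
theorem zmod3_solve_mid (K x w : ZMod 3) : (x + w = -K) ↔ ¬ (K + x + w ≠ 0) := by
  revert K x w; decide

/-- Prefix weights INSIDE the block see the prefix block and a prefix of the content. -/
theorem wtPrefix_glue3_of_mem (v : Fin ℓ → Bool) {g : ℕ} (h1 : L ≤ g) (h2 : g ≤ L + ℓ) :
    wtPrefix (glue3 a v b) g = wt a + wtPrefix v (g - L) := by
  unfold glue3
  rw [wtPrefix_append_of_le _ _ h2, wtPrefix_append_of_ge _ _ h1]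

/-- **The dead value of a cut** (depends on the charge, the position and the OUTSIDE bits only): `−(c + g + |a| + |b| + |a_{<g}|)`
for a cut left of the block (`g ≤ L`), `c + g + 2|a| + |b| + |b_{<g−L−ℓ}|` for a cut right of it (`L + ℓ ≤ g`), `−(c + g + 2|a| + |b|)` for a
cut inside. -/
def deadVal (ℓ c : ℕ) (a : Fin L → Bool) (b : Fin R → Bool) (g : ℕ) : ZMod 3 :=
  if g ≤ L then -((c + g + wt a + wt b + wtPrefix a g : ℕ) : ZMod 3)
  else if L + ℓ ≤ g then ((c + g + wt a + wt b + wt a + wtPrefix b (g - (L + ℓ)) : ℕ) : ZMod 3)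
  else -((c + g + 2 * wt a + wt b : ℕ) : ZMod 3)

/-- **The block label** of a content `v` relative to inside positions `h₁ … h_J`: `(|v| ; |v_{<h_j − L}|)` mod 3. -/
def blockLabel (L : ℕ) {J : ℕ} (h : Fin J → ℕ) (v : Fin ℓ → Bool) : ZMod 3 × (Fin J → ZMod 3) :=
  (((wt v : ℕ) : ZMod 3), fun j => ((wtPrefix v (h j - L) : ℕ) : ZMod 3))

/-- **THE DICTIONARY, CERTIFIED.**  Fix the outside bits `a, b`, a content `v`, the set `P` of cuts passing at `u = a ++ v ++ b`, and a
classification `kind` of the passing cuts: `none` ⟹ the cut is outside the block (`g ≤ L` or `L + ℓ ≤ g`), `some j` ⟹ it sits at the inside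
position `h j` (`L < h j < L + ℓ`).  Then the walk game's `ringWinU c y u` is `true` iff the block label of `v` is a WINNING LABEL for
`(kind, deadVal)` in the sense of §31.  Hence on any set of contents `v` with the same pass set `P` (an affine sub-fibre for linear tests),
`#WIN = Σ_z #{v : blockLabel v = z}·[WinLabel z]`, and `multiLiveness` bounds the winning labels by two thirds. -/
theorem ringWinU_glue3_iff_winLabel {J : ℕ} (h : Fin J → ℕ) (v : Fin ℓ → Bool)
    (P : Finset (Fin (L + ℓ + R + 1))) (hP : ∀ g, g ∈ P ↔ y g (glue3 a v b) = true)
    (kind : {g // g ∈ P} → Option (Fin J))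
    (hnone : ∀ g, kind g = none → (g.1.val ≤ L ∨ L + ℓ ≤ g.1.val))
    (hsome : ∀ g j, kind g = some j → g.1.val = h j ∧ L < h j ∧ h j < L + ℓ) :
    ringWinU c y (glue3 a v b) = true ↔
      WinLabel kind (fun g => deadVal ℓ c a b g.1.val) (blockLabel L h v) := by
  -- Step 1: WIN ↔ the number of passing live cuts is odd, counted on `P`
  have h1 : ringWinU c y (glue3 a v b) = true ↔
      (P.filter fun g => (c + g.val + walkExp (glue3 a v b) g.val) % 3 ≠ 0).card % 2 = 1 := by
    unfold ringWinU
    rw [decide_eq_true_iff]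
    have hF : (univ.filter fun g : Fin (L + ℓ + R + 1) =>
        y g (glue3 a v b) = true ∧ (c + g.val + walkExp (glue3 a v b) g.val) % 3 ≠ 0) =
        P.filter fun g => (c + g.val + walkExp (glue3 a v b) g.val) % 3 ≠ 0 := by
      ext g
      rw [Finset.mem_filter, Finset.mem_filter, hP g]
      simp
    rw [hF]
  -- Step 2: count on the subtype of passing cuts
  have h2 : (P.filter fun g => (c + g.val + walkExp (glue3 a v b) g.val) % 3 ≠ 0).card =
      (univ.filter fun g : {g // g ∈ P} => (c + g.1.val + walkExp (glue3 a v b) g.1.val) % 3 ≠ 0).card := by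
    rw [Finset.card_filter, Finset.card_filter]
    exact Finset.sum_subtype P (fun _ => Iff.rfl)
      (fun g : Fin (L + ℓ + R + 1) => if (c + g.val + walkExp (glue3 a v b) g.val) % 3 ≠ 0 then 1 else 0)
  -- Step 3: the per-cut dictionary: dead at the label ↔ not live
  have h3 : ∀ g : {g // g ∈ P},
      ((blockLabel L h v).1 + coordOf (blockLabel L h v) (kind g) = deadVal ℓ c a b g.1.val) ↔
        ¬ ((c + g.1.val + walkExp (glue3 a v b) g.1.val) % 3 ≠ 0) := by
    intro g
    have hwt : wt (glue3 a v b) = wt a + wt v + wt b := wt_glue3 a v b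
    cases hk : kind g with
    | none =>
      by_cases hle : g.1.val ≤ L
      · -- cut left of the block: reads `z₀`
        have hpre : wtPrefix (glue3 a v b) g.1.val = wtPrefix a g.1.val := wtPrefix_glue3_of_le a v b hle
        have hexp : c + g.1.val + walkExp (glue3 a v b) g.1.val =
            (c + g.1.val + wt a + wt b + wtPrefix a g.1.val) + wt v := by
          unfold walkExp; rw [hwt, hpre]; omega
        simp only [coordOf, blockLabel, deadVal, if_pos hle]
        rw [hexp, natMod3_ne_zero_iff, Nat.cast_add (R := ZMod 3) (c + g.1.val + wt a + wt b + wtPrefix a g.1.val) (wt v)]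
        exact zmod3_solve_left _ _
      · -- cut right of the block: reads `2 z₀`
        have hge : L + ℓ ≤ g.1.val := by
          rcases hnone g hk with h' | h'
          · exact absurd h' hle
          · exact h'
        have hpre : wtPrefix (glue3 a v b) g.1.val = wt a + wt v + wtPrefix b (g.1.val - (L + ℓ)) :=
          wtPrefix_glue3_of_ge a v b hge
        have hexp : c + g.1.val + walkExp (glue3 a v b) g.1.val =
            (c + g.1.val + wt a + wt b + wt a + wtPrefix b (g.1.val - (L + ℓ))) + 2 * wt v := by
          unfold walkExp; rw [hwt, hpre]; omega
        simp only [coordOf, blockLabel, deadVal, if_neg hle, if_pos hge]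
        rw [hexp, natMod3_ne_zero_iff,
          Nat.cast_add (R := ZMod 3) (c + g.1.val + wt a + wt b + wt a + wtPrefix b (g.1.val - (L + ℓ))) (2 * wt v),
          Nat.cast_mul (α := ZMod 3) 2 (wt v), Nat.cast_ofNat]
        exact zmod3_solve_right _ _
    | some j =>
      obtain ⟨hg, hj1, hj2⟩ := hsome g j hk
      have hpre : wtPrefix (glue3 a v b) g.1.val = wt a + wtPrefix v (g.1.val - L) :=
        wtPrefix_glue3_of_mem a b v (by omega) (by omega)
      have hexp : c + g.1.val + walkExp (glue3 a v b) g.1.val =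
          (c + g.1.val + 2 * wt a + wt b) + wt v + wtPrefix v (h j - L) := by
        unfold walkExp; rw [hwt, hpre, hg]; omega
      have hn1 : ¬ g.1.val ≤ L := by omega
      have hn2 : ¬ L + ℓ ≤ g.1.val := by omega
      simp only [coordOf, blockLabel, deadVal, if_neg hn1, if_neg hn2]
      rw [hexp, natMod3_ne_zero_iff, Nat.cast_add (R := ZMod 3) (c + g.1.val + 2 * wt a + wt b + wt v) (wtPrefix v (h j - L)),
        Nat.cast_add (R := ZMod 3) (c + g.1.val + 2 * wt a + wt b) (wt v)]
      exact zmod3_solve_mid _ _ _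
  -- Step 4: dead count = number of passing cuts that are not live; parity bookkeeping
  have h4 : deadCount kind (fun g => deadVal ℓ c a b g.1.val) (blockLabel L h v) =
      (univ.filter fun g : {g // g ∈ P} => ¬ ((c + g.1.val + walkExp (glue3 a v b) g.1.val) % 3 ≠ 0)).card := by
    unfold deadCount
    exact congrArg Finset.card (Finset.filter_congr fun g _ => h3 g)
  have h5 := Finset.card_filter_add_card_filter_not (s := (univ : Finset {g // g ∈ P}))
    (fun g : {g // g ∈ P} => (c + g.1.val + walkExp (glue3 a v b) g.1.val) % 3 ≠ 0)
  have h6 : (univ : Finset {g // g ∈ P}).card = Fintype.card {g // g ∈ P} := Finset.card_univ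
  unfold WinLabel
  rw [h1, h2, h4]
  omega

/-- **Corollary (the counting skeleton of every block law).**  On a set `V` of contents with a common pass set `P` classified as above,
the winners are exactly the contents whose label is winning: `#{v ∈ V : WIN} = #{v ∈ V : WinLabel (blockLabel v)}` — so that
`#{v ∈ V : WIN} = Σ_{z winning} #{v ∈ V : blockLabel v = z}` and `multiLiveness` caps the winning labels at `2·3^{J+1}/3`. -/
theorem card_win_eq_card_winLabel {J : ℕ} (h : Fin J → ℕ) (P : Finset (Fin (L + ℓ + R + 1)))
    (kind : {g // g ∈ P} → Option (Fin J))
    (hnone : ∀ g, kind g = none → (g.1.val ≤ L ∨ L + ℓ ≤ g.1.val))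
    (hsome : ∀ g j, kind g = some j → g.1.val = h j ∧ L < h j ∧ h j < L + ℓ)
    (V : Finset (Fin ℓ → Bool)) (hV : ∀ v ∈ V, ∀ g, g ∈ P ↔ y g (glue3 a v b) = true) :
    (V.filter fun v => ringWinU c y (glue3 a v b) = true).card =
      (V.filter fun v => WinLabel kind (fun g => deadVal ℓ c a b g.1.val) (blockLabel L h v)).card :=
  congrArg Finset.card (Finset.filter_congr fun v hv =>
    ringWinU_glue3_iff_winLabel c y a b h v P (hV v hv) kind hnone hsome)

end WalkBridge

end Summit.QuantumAdvantage.QuantumAdvantage.Theorems.RankDial
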